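import Mathlib
import HarnessLib
import Summits.Ventures.LatticeQCDFlow.Scaling.PlaquetteIndependence2D
import Summits.Ventures.LatticeQCDFlow.Scaling.WilsonIdentityFlowLaw
import Summits.Ventures.LatticeQCDFlow.Scoring.TorusAreaLaw2D

/-!
# LatticeQCDFlow / Scaling — THE TORUS: the untrained sampler of 2-d Wilson lattice gauge theory on
# the periodic `L × L` torus has the acceptance of the FACTORISED `(L² − 1)`-plaquette sampler up
# to the factor `e^{±4|β|N}`, for every compact gauge group, every `L ≥ 2` and every coupling

HONEST FRAMING: exact (Metropolis-corrected) sampling algorithms for lattice gauge theory;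
figures of merit are autocorrelation/cost numbers at stated couplings and volumes; no
continuum-physics claim.

Venture `LatticeQCDFlow` (cell pub-lqcd), topic `Scaling`; FANOUT row 3 (`s0-u1-a`, S0-B
implementation A: the 2-d flow sampler on the `16 × 16` torus, GEN-21).  NEW WORK of the cell, no
numerics, NO definition.  Row 3's large-volume laws for the UNTRAINED (identity-flow) exact sampler
(GEN-12…20: geometric collapse, coupling window `β = Θ(V^{−1/2})`, the diagonal log-normal
acceptance law `erfc(|c|σ/2)`, the loss dictionary) are proved for the FACTORISED model — `n`
independent plaquette variables — and list "the torus" as NOT CLAIMED.  On the periodic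
two-dimensional torus the plaquettes are not independent (their ordered product is constrained), but
row 30's `Scaling/PlaquetteIndependence2D` (`map_plaquettes_eq_pi`, imported) proves that under
product Haar measure on the links of `(ℤ/L)²`, `L ≥ 2`, the holonomies of the `L² − 1` plaquettes
off one puncture `x₀` are independent and Haar distributed.  Writing the Boltzmann factor as
`e^{−βS(U)} = e^{β(Re tr ρ(U_{x₀}) − N)} · ∏_{x ≠ x₀} e^{β(Re tr ρ(U_x) − N)}` and bounding the
single punctured factor by `e^{±2|β|N}` (`|Re tr ρ| ≤ N`, the tree's unitary trick
`Literature…UnitaryTrick`), every functional of the sampler that is monotone and homogeneous in the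
weight transfers between the torus and the factorised model:

* §1 `integral_sandwich_of_exp_mul_le`, `pairMin_sandwich_of_exp_mul_le`,
  `ratio_sandwich_of_sandwich` — on any finite measure space, `e^{−δ}P ≤ W ≤ e^{δ}P` gives
  `e^{−δ}∫P ≤ ∫W ≤ e^{δ}∫P`, the same for the pair functional `∫∫ min(W, W′)`, hence
  `e^{∓2δ}` for the ratio;
* §2 torus plumbing: `neg_mul_wilsonAction_two` (`−βS = β Σ_x (Re tr ρ(U_x) − N)` on `(ℤ/L)²`),
  `sum_site_eq_add_sum_ne`, `abs_re_trace_sub_card_le`, and `integral_comp_plaquettes` — integrals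
  of functions of the punctured plaquette field `(U_x)_{x ≠ x₀}` against `Haar^{⊗E}` are integrals
  against `Haar^{⊗(L²−1)}` (row 30's theorem read on integrals);
* §3 **`torus_meanAccept_sandwich`** — for EVERY compact second-countable `G`, continuous `ρ`,
  `L ≥ 2`, puncture `x₀` and real `β`: the equilibrium acceptance
  `acc_T(β) = ∫∫ min(p(U), p(U′)) dHaar^{⊗E} dHaar^{⊗E}`, `p = e^{−βS}/Z` (row 3's
  `Scaling/WilsonIdentityFlowLaw` convention) of the untrained exact sampler on the torus satisfies
  `e^{−4|β|N}·acc_F(β) ≤ acc_T(β) ≤ e^{4|β|N}·acc_F(β)`, where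
  `acc_F(β) = (∫∫ min(e^{βT}, e^{βT′}))/∫ e^{βT}`, `T(y) = Σ_{x ≠ x₀} (Re tr ρ(y_x) − N)`, is row 3's
  acceptance functional (`Scaling/IdentityFlowAcceptanceDiagonalLimit`, `TiltAcceptanceJensenFloor`)
  of the factorised sampler with `L² − 1` independent Haar-distributed plaquettes.

Reading (value-free; no number of ours is computed or implied): in two dimensions the single global
constraint of the periodic torus changes the untrained sampler's equilibrium acceptance by at most
the factor `e^{±4|β|N}`, uniformly in the volume; in the coupling window `β = Θ(1/L)` where that
acceptance is non-trivial the factor tends to one, so every large-volume acceptance law of the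
factorised model is a law of the torus (sibling file `Scaling/TorusAcceptanceDiagonalLimit2D`:
transfer of limits and the diagonal log-normal law `erfc(|c|σ/2)` on the torus).  NOT CLAIMED here:
the limits themselves; ESS / partition function / training loss on the torus (sibling file);
`d ≥ 3` (plaquettes are not independent off a point there); trained flows; the sharper one-sided
factor `e^{±2βN}` for `β ≥ 0`; any value at the cell's `(β, L)`; nothing re-scored, SEALED.md
untouched.
-/

noncomputable section

namespace Summit.Ventures.LatticeQCDFlow.Theory2

open MeasureTheory Finset Real Set
open Literature.MathematicalPhysics.QuantumFieldTheory

/-! ## §1 Bounded-factor perturbation of integrals and of the pair functional -/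

section Perturb

variable {Ω : Type*} [MeasurableSpace Ω] {μ : Measure Ω}

/-- **Bounded-factor perturbation of an integral**: `e^{−δ}P ≤ W ≤ e^{δ}P` pointwise for integrable
`P`, `W` gives `e^{−δ}∫P ≤ ∫W ≤ e^{δ}∫P`. [ours] -/
theorem integral_sandwich_of_exp_mul_le {P W : Ω → ℝ} {δ : ℝ} (hPi : Integrable P μ)
    (hWi : Integrable W μ) (hlo : ∀ ω, Real.exp (-δ) * P ω ≤ W ω)
    (hhi : ∀ ω, W ω ≤ Real.exp δ * P ω) :
    Real.exp (-δ) * ∫ ω, P ω ∂μ ≤ ∫ ω, W ω ∂μ ∧ ∫ ω, W ω ∂μ ≤ Real.exp δ * ∫ ω, P ω ∂μ := by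
  refine ⟨?_, ?_⟩
  · rw [← integral_const_mul]
    exact integral_mono (hPi.const_mul _) hWi hlo
  · rw [← integral_const_mul]
    exact integral_mono hWi (hPi.const_mul _) hhi

/-- The pair functional `(ω, ω′) ↦ min(F ω, F ω′)` of a bounded non-negative measurable `F` is
integrable on the product of a finite measure with itself. [ours] -/
theorem integrable_min_prod [IsFiniteMeasure μ] {F : Ω → ℝ} (hFm : Measurable F) {C : ℝ}
    (hF0 : ∀ ω, 0 ≤ F ω) (hFC : ∀ ω, F ω ≤ C) :
    Integrable (fun z : Ω × Ω => min (F z.1) (F z.2)) (μ.prod μ) :=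
  Integrable.of_mem_Icc 0 C
    ((hFm.comp measurable_fst).min (hFm.comp measurable_snd)).aemeasurable
    (ae_of_all _ fun z => ⟨le_min (hF0 z.1) (hF0 z.2), (min_le_left _ _).trans (hFC z.1)⟩)

/-- **Bounded-factor perturbation of the pair functional** `N(F) = ∫∫ min(F ω, F ω′) dμ dμ`: if
`e^{−δ}P ≤ W ≤ e^{δ}P` with `P ≥ 0` (both bounded measurable, `μ` finite) then
`e^{−δ}N(P) ≤ N(W) ≤ e^{δ}N(P)`. [ours] -/
theorem pairMin_sandwich_of_exp_mul_le [IsFiniteMeasure μ] {P W : Ω → ℝ} {δ C D : ℝ}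
    (hPm : Measurable P) (hWm : Measurable W) (hP0 : ∀ ω, 0 ≤ P ω) (hPC : ∀ ω, P ω ≤ C)
    (hWD : ∀ ω, W ω ≤ D) (hlo : ∀ ω, Real.exp (-δ) * P ω ≤ W ω)
    (hhi : ∀ ω, W ω ≤ Real.exp δ * P ω) :
    Real.exp (-δ) * ∫ ω, ∫ ω', min (P ω) (P ω') ∂μ ∂μ ≤ ∫ ω, ∫ ω', min (W ω) (W ω') ∂μ ∂μ ∧
      ∫ ω, ∫ ω', min (W ω) (W ω') ∂μ ∂μ ≤ Real.exp δ * ∫ ω, ∫ ω', min (P ω) (P ω') ∂μ ∂μ := by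
  have hW0 : ∀ ω, 0 ≤ W ω := fun ω => (mul_nonneg (Real.exp_pos _).le (hP0 ω)).trans (hlo ω)
  have hIP := integrable_min_prod (μ := μ) hPm hP0 hPC
  have hIW := integrable_min_prod (μ := μ) hWm hW0 hWD
  have eP : ∫ z, min (P z.1) (P z.2) ∂(μ.prod μ) = ∫ ω, ∫ ω', min (P ω) (P ω') ∂μ ∂μ :=
    integral_prod _ hIP
  have eW : ∫ z, min (W z.1) (W z.2) ∂(μ.prod μ) = ∫ ω, ∫ ω', min (W ω) (W ω') ∂μ ∂μ :=
    integral_prod _ hIW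
  rw [← eP, ← eW]
  refine integral_sandwich_of_exp_mul_le hIP hIW (fun z => ?_) (fun z => ?_)
  · rw [mul_min_of_nonneg _ _ (Real.exp_pos _).le]
    exact min_le_min (hlo z.1) (hlo z.2)
  · rw [mul_min_of_nonneg _ _ (Real.exp_pos _).le]
    exact min_le_min (hhi z.1) (hhi z.2)

/-- Ratio form of a two-sided sandwich: `e^{−δ}N ≤ N′ ≤ e^{δ}N`, `e^{−δ}Z ≤ Z′ ≤ e^{δ}Z` with `N ≥ 0`,
`Z > 0` give `e^{−2δ}·N/Z ≤ N′/Z′ ≤ e^{2δ}·N/Z`. [ours] -/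
theorem ratio_sandwich_of_sandwich {N N' Z Z' δ : ℝ} (hN : 0 ≤ N) (hZ : 0 < Z)
    (hNlo : Real.exp (-δ) * N ≤ N') (hNhi : N' ≤ Real.exp δ * N)
    (hZlo : Real.exp (-δ) * Z ≤ Z') (hZhi : Z' ≤ Real.exp δ * Z) :
    Real.exp (-(2 * δ)) * (N / Z) ≤ N' / Z' ∧ N' / Z' ≤ Real.exp (2 * δ) * (N / Z) := by
  have hZ' : 0 < Z' := lt_of_lt_of_le (mul_pos (Real.exp_pos _) hZ) hZlo
  have hN' : 0 ≤ N' := (mul_nonneg (Real.exp_pos _).le hN).trans hNlo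
  have e1 : Real.exp (-(2 * δ)) * (N / Z) = (Real.exp (-δ) * N) / (Real.exp δ * Z) := by
    rw [show -(2 * δ) = -δ - δ by ring, Real.exp_sub]
    field_simp
  have e2 : Real.exp (2 * δ) * (N / Z) = (Real.exp δ * N) / (Real.exp (-δ) * Z) := by
    rw [show (2 * δ) = δ - -δ by ring, Real.exp_sub]
    field_simp
  refine ⟨?_, ?_⟩
  · rw [e1]
    exact div_le_div₀ hN' hNlo hZ' hZhi
  · rw [e2]
    exact div_le_div₀ (mul_nonneg (Real.exp_pos _).le hN) hNhi (mul_pos (Real.exp_pos _) hZ) hZlo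

end Perturb

/-! ## §2 Torus plumbing on `(ℤ/L)²`: the weight as a sum over sites, the punctured plaquette field -/

section Torus

open Lattice.TwoDim

variable {L N : ℕ} {G : Type*} [Group G] [TopologicalSpace G] [IsTopologicalGroup G]
  [CompactSpace G] [SecondCountableTopology G] [MeasurableSpace G] [BorelSpace G]
  (ρ : G →* Matrix (Fin N) (Fin N) ℂ)

omit [TopologicalSpace G] [IsTopologicalGroup G] [CompactSpace G] [SecondCountableTopology G]
  [MeasurableSpace G] [BorelSpace G] in
/-- On `(ℤ/L)²` the Boltzmann exponent is a sum over the sites of the `(0,1)`-plaquette terms: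
`−βS(U) = β Σ_x (Re tr ρ(U_x) − N)` — the logarithm of row 5's product form
`Scoring/TorusAreaLaw2D.exp_neg_mul_wilsonAction_two` (reused). [folklore] -/
theorem neg_mul_wilsonAction_two [NeZero L] (β : ℝ) (U : GaugeConfig 2 L G) :
    -β * wilsonAction ρ U =
      β * ∑ x : Site 2 L, ((ρ (plaquetteHolonomy U x 0 1)).trace.re - N) := by
  have h := Scoring.exp_neg_mul_wilsonAction_two ρ β U
  rw [← Real.exp_sum] at h
  rw [Real.exp_injective h, Finset.mul_sum]
  exact Finset.sum_congr rfl fun x _ => by ring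

omit [TopologicalSpace G] [IsTopologicalGroup G] [CompactSpace G] [SecondCountableTopology G]
  [MeasurableSpace G] [BorelSpace G] in
/-- Splitting the site sum at the puncture `x₀`: `Σ_x a_x = a_{x₀} + Σ_{x ≠ x₀} a_x`, the second sum
indexed by the subtype `{x // x ≠ x₀}`. [folklore] -/
theorem sum_site_eq_add_sum_ne [NeZero L] (x₀ : Site 2 L) (a : Site 2 L → ℝ) :
    ∑ x, a x = a x₀ + ∑ x : {x : Site 2 L // x ≠ x₀}, a x.1 := by
  classical
  rw [← Finset.add_sum_erase _ _ (Finset.mem_univ x₀),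
    Finset.sum_subtype (Finset.univ.erase x₀) (p := fun x => x ≠ x₀) (fun x => by simp) a]

omit [SecondCountableTopology G] [MeasurableSpace G] [BorelSpace G] in
/-- `|Re tr ρ(g) − N| ≤ 2N` for a continuous `N`-dimensional representation of a compact group
(`|Re tr ρ| ≤ N`, the tree's unitary trick). [folklore] -/
theorem abs_re_trace_sub_card_le (hρ : Continuous ρ) (g : G) :
    |(ρ g).trace.re - N| ≤ 2 * N := by
  have h := Literature.RepresentationTheory.CompactGroups.CompactGroup.abs_re_trace_le_card ρ hρ g
  rw [Fintype.card_fin] at h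
  have h1 := abs_le.1 h
  rw [abs_le]
  constructor <;> linarith [h1.1, h1.2]

/-- **Integration against the punctured plaquette field.**  For every strongly measurable
`Ψ : ({x // x ≠ x₀} → G) → ℝ`: `∫ Ψ((U_x)_{x ≠ x₀}) dHaar^{⊗E}(U) = ∫ Ψ dHaar^{⊗(L²−1)}` — row 30's
`map_plaquettes_eq_pi` read on integrals (strong measurability, not continuity, is what the
parametric pair integral of §3 supplies; cf. the continuous sub-family form
`Scoring/InfiniteVolumePlaquetteLaw2D.integral_comp_plaquettes_eq_integral_pi`, not imported). [ours] -/
theorem integral_comp_plaquettes [NeZero L] (hL : 2 ≤ L) (x₀ : Site 2 L)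
    {Ψ : ({x : Site 2 L // x ≠ x₀} → G) → ℝ} (hΨ : StronglyMeasurable Ψ) :
    ∫ U, Ψ (fun x => plaquetteHolonomy U x.1 0 1) ∂(Measure.pi fun _ : Edge 2 L => haarProbability G)
      = ∫ y, Ψ y ∂(Measure.pi fun _ : {x : Site 2 L // x ≠ x₀} => haarProbability G) := by
  rw [← map_plaquettes_eq_pi hL x₀, integral_map
    (measurable_pi_lambda _ fun x => measurable_plaquetteHolonomy (G := G) x.1).aemeasurable
    hΨ.aestronglyMeasurable]

/-! ## §3 The torus acceptance versus the factorised `(L² − 1)`-block acceptance -/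

/-- **THE TORUS ACCEPTANCE SANDWICH.**  On `(ℤ/L)²`, `L ≥ 2`, for every compact second-countable
gauge group `G`, continuous representation `ρ`, puncture `x₀` and real coupling `β`, the equilibrium
acceptance `acc_T(β) = ∫∫ min(p(U), p(U′)) dHaar^{⊗E} dHaar^{⊗E}`, `p = e^{−βS}/Z`, of the untrained
exact sampler (Haar-distributed links proposed against the Wilson law) satisfies
`e^{−4|β|N}·acc_F(β) ≤ acc_T(β) ≤ e^{4|β|N}·acc_F(β)`, where
`acc_F(β) = (∫∫ min(e^{βT(y)}, e^{βT(y′)}) dHaar^{⊗I} dHaar^{⊗I}) / ∫ e^{βT} dHaar^{⊗I}`,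
`T(y) = Σ_{x ∈ I} (Re tr ρ(y_x) − N)`, `I = {x ≠ x₀}`, is the acceptance functional of the FACTORISED
sampler with `L² − 1` independent Haar plaquettes. [ours] -/
theorem torus_meanAccept_sandwich [NeZero L] (hL : 2 ≤ L) (x₀ : Site 2 L) (hρ : Continuous ρ)
    (β : ℝ) :
    Real.exp (-(4 * |β| * N)) *
        ((∫ y, ∫ y', min (Real.exp (β * ∑ x, ((ρ (y x)).trace.re - N)))
              (Real.exp (β * ∑ x, ((ρ (y' x)).trace.re - N)))
            ∂(Measure.pi fun _ : {x : Site 2 L // x ≠ x₀} => haarProbability G)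
            ∂(Measure.pi fun _ : {x : Site 2 L // x ≠ x₀} => haarProbability G)) /
          ∫ y, Real.exp (β * ∑ x, ((ρ (y x)).trace.re - N))
            ∂(Measure.pi fun _ : {x : Site 2 L // x ≠ x₀} => haarProbability G)) ≤
      ∫ U, ∫ U', min
          (Real.exp (-β * wilsonAction ρ U) /
            ∫ V, Real.exp (-β * wilsonAction ρ V) ∂(Measure.pi fun _ : Edge 2 L => haarProbability G))
          (Real.exp (-β * wilsonAction ρ U') /
            ∫ V, Real.exp (-β * wilsonAction ρ V) ∂(Measure.pi fun _ : Edge 2 L => haarProbability G))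
        ∂(Measure.pi fun _ : Edge 2 L => haarProbability G)
        ∂(Measure.pi fun _ : Edge 2 L => haarProbability G) ∧
    ∫ U, ∫ U', min
          (Real.exp (-β * wilsonAction ρ U) /
            ∫ V, Real.exp (-β * wilsonAction ρ V) ∂(Measure.pi fun _ : Edge 2 L => haarProbability G))
          (Real.exp (-β * wilsonAction ρ U') /
            ∫ V, Real.exp (-β * wilsonAction ρ V) ∂(Measure.pi fun _ : Edge 2 L => haarProbability G))
        ∂(Measure.pi fun _ : Edge 2 L => haarProbability G)
        ∂(Measure.pi fun _ : Edge 2 L => haarProbability G) ≤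
      Real.exp (4 * |β| * N) *
        ((∫ y, ∫ y', min (Real.exp (β * ∑ x, ((ρ (y x)).trace.re - N)))
              (Real.exp (β * ∑ x, ((ρ (y' x)).trace.re - N)))
            ∂(Measure.pi fun _ : {x : Site 2 L // x ≠ x₀} => haarProbability G)
            ∂(Measure.pi fun _ : {x : Site 2 L // x ≠ x₀} => haarProbability G)) /
          ∫ y, Real.exp (β * ∑ x, ((ρ (y x)).trace.re - N))
            ∂(Measure.pi fun _ : {x : Site 2 L // x ≠ x₀} => haarProbability G)) := by
  -- names
  set μE : Measure (GaugeConfig 2 L G) := Measure.pi fun _ : Edge 2 L => haarProbability G with hμE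
  set μI : Measure ({x : Site 2 L // x ≠ x₀} → G) :=
    Measure.pi fun _ : {x : Site 2 L // x ≠ x₀} => haarProbability G with hμI
  set T : ({x : Site 2 L // x ≠ x₀} → G) → ℝ := fun y => ∑ x, ((ρ (y x)).trace.re - N) with hT
  set Ψ : ({x : Site 2 L // x ≠ x₀} → G) → ℝ := fun y => Real.exp (β * T y) with hΨ
  set plq : GaugeConfig 2 L G → ({x : Site 2 L // x ≠ x₀} → G) :=
    fun U x => plaquetteHolonomy U x.1 0 1 with hplq
  set W : GaugeConfig 2 L G → ℝ := fun U => Real.exp (-β * wilsonAction ρ U) with hW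
  set P : GaugeConfig 2 L G → ℝ := fun U => Ψ (plq U) with hP
  set δ : ℝ := 2 * |β| * N with hδ
  -- continuity / measurability
  have hr : Continuous fun g : G => (ρ g).trace.re := Complex.continuous_re.comp hρ.matrix_trace
  have hTc : Continuous T :=
    continuous_finsetSum _ fun x _ => (hr.comp (continuous_apply x)).sub continuous_const
  have hΨc : Continuous Ψ := Real.continuous_exp.comp (continuous_const.mul hTc)
  have hplqm : Measurable plq := measurable_pi_lambda _ fun x => measurable_plaquetteHolonomy (G := G) x.1
  have hPm : Measurable P := hΨc.measurable.comp hplqm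
  have hWm : Measurable W :=
    Real.measurable_exp.comp ((WilsonRP.measurable_wilsonAction ρ hρ).const_mul _)
  -- the split `W = R · P` and the bounds on the punctured factor
  have hsplit : ∀ U, W U = Real.exp (β * ((ρ (plaquetteHolonomy U x₀ 0 1)).trace.re - N)) * P U := by
    intro U
    simp only [hW, hP, hΨ, hT, hplq]
    rw [neg_mul_wilsonAction_two ρ β U, sum_site_eq_add_sum_ne x₀, mul_add, Real.exp_add]
  have hR : ∀ g : G, Real.exp (-δ) ≤ Real.exp (β * ((ρ g).trace.re - N)) ∧
      Real.exp (β * ((ρ g).trace.re - N)) ≤ Real.exp δ := by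
    intro g
    have hb : |β * ((ρ g).trace.re - N)| ≤ δ := by
      rw [abs_mul, hδ, show 2 * |β| * (N : ℝ) = |β| * (2 * N) by ring]
      exact mul_le_mul_of_nonneg_left (abs_re_trace_sub_card_le ρ hρ g) (abs_nonneg _)
    exact ⟨Real.exp_le_exp.2 (abs_le.1 hb).1, Real.exp_le_exp.2 (abs_le.1 hb).2⟩
  have hP0 : ∀ U, 0 ≤ P U := fun U => (Real.exp_pos _).le
  have hlo : ∀ U, Real.exp (-δ) * P U ≤ W U := fun U => by
    rw [hsplit U]; exact mul_le_mul_of_nonneg_right (hR _).1 (hP0 U)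
  have hhi : ∀ U, W U ≤ Real.exp δ * P U := fun U => by
    rw [hsplit U]; exact mul_le_mul_of_nonneg_right (hR _).2 (hP0 U)
  -- crude uniform bounds
  have hTb : ∀ y, |β * T y| ≤ |β| * ∑ _x : {x : Site 2 L // x ≠ x₀}, (2 * (N : ℝ)) := fun y => by
    rw [abs_mul]
    refine mul_le_mul_of_nonneg_left ((Finset.abs_sum_le_sum_abs _ _).trans
      (Finset.sum_le_sum fun x _ => abs_re_trace_sub_card_le ρ hρ (y x))) (abs_nonneg _)
  set B : ℝ := |β| * ∑ _x : {x : Site 2 L // x ≠ x₀}, (2 * (N : ℝ)) with hB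
  have hΨB : ∀ y, Ψ y ≤ Real.exp B := fun y => Real.exp_le_exp.2 (abs_le.1 (hTb y)).2
  have hΨ0 : ∀ y, 0 ≤ Ψ y := fun y => (Real.exp_pos _).le
  have hPB : ∀ U, P U ≤ Real.exp B := fun U => hΨB _
  have hWB : ∀ U, W U ≤ Real.exp δ * Real.exp B := fun U =>
    (hhi U).trans (mul_le_mul_of_nonneg_left (hPB U) (Real.exp_pos _).le)
  -- integrability
  have hPi : Integrable P μE := Integrable.of_mem_Icc 0 (Real.exp B) hPm.aemeasurable
    (ae_of_all _ fun U => ⟨hP0 U, hPB U⟩)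
  have hWi : Integrable W μE := integrable_exp_mul_wilsonAction ρ hρ (-β) μE
  have hΨi : Integrable Ψ μI := Integrable.of_mem_Icc 0 (Real.exp B) hΨc.measurable.aemeasurable
    (ae_of_all _ fun y => ⟨hΨ0 y, hΨB y⟩)
  -- the partition functions
  have hZ := integral_sandwich_of_exp_mul_le hPi hWi hlo hhi
  have hZP : ∫ U, P U ∂μE = ∫ y, Ψ y ∂μI := integral_comp_plaquettes hL x₀ hΨc.stronglyMeasurable
  -- the pair functionals
  have hNN := pairMin_sandwich_of_exp_mul_le (μ := μE) hPm hWm hP0 hPB hWB hlo hhi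
  have hΘ : StronglyMeasurable fun y => ∫ y', min (Ψ y) (Ψ y') ∂μI :=
    StronglyMeasurable.integral_prod_right'
      ((hΨc.comp continuous_fst).min (hΨc.comp continuous_snd)).stronglyMeasurable
  have hNP : ∫ U, ∫ U', min (P U) (P U') ∂μE ∂μE = ∫ y, ∫ y', min (Ψ y) (Ψ y') ∂μI ∂μI := by
    have inner : ∀ U, ∫ U', min (P U) (P U') ∂μE = ∫ y', min (Ψ (plq U)) (Ψ y') ∂μI := fun U =>
      integral_comp_plaquettes hL x₀ (continuous_const.min hΨc).stronglyMeasurable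
    simp_rw [inner]
    exact integral_comp_plaquettes hL x₀ hΘ
  -- positivity of the factorised quantities
  have hZF : 0 < ∫ y, Ψ y ∂μI := integral_exp_pos hΨi
  have hNF : 0 ≤ ∫ y, ∫ y', min (Ψ y) (Ψ y') ∂μI ∂μI :=
    integral_nonneg fun y => integral_nonneg fun y' => le_min (hΨ0 _) (hΨ0 _)
  -- the ratio sandwich
  rw [hZP] at hZ
  rw [hNP] at hNN
  have hrat := ratio_sandwich_of_sandwich hNF hZF hNN.1 hNN.2 hZ.1 hZ.2
  -- the torus acceptance in normalised form is the ratio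
  have hZT : 0 < ∫ U, W U ∂μE := wilsonZI_pos ρ μE hρ β
  have hacc : ∫ U, ∫ U', min (W U / ∫ V, W V ∂μE) (W U' / ∫ V, W V ∂μE) ∂μE ∂μE =
      (∫ U, ∫ U', min (W U) (W U') ∂μE ∂μE) / ∫ V, W V ∂μE := by
    simp_rw [min_div_div_right hZT.le, integral_div]
  have e4 : 2 * δ = 4 * |β| * N := by rw [hδ]; ring
  rw [← e4]
  simp only [hW] at hacc
  rw [hacc]
  exact hrat

end Torus

end Summit.Ventures.LatticeQCDFlow.Theory2

end
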